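import Mathlib
import HarnessLib
import HarnessLib.Audit
import Summits.Langlands.Statement
import Literature.NumberTheory.GaloisRepresentations.EvenGaloisRep
import Literature.NumberTheory.GaloisRepresentations.ResidualGaloisRep
import Literature.NumberTheory.GaloisRepresentations.ProjectiveType
import Literature.NumberTheory.GaloisRepresentations.LabelledHodgeTateWeights
import HarnessLib.Audit.Status.Attr

/-!
Route: EvenVoidBelowEight

DORMANT since 2026-08-24T05:41:55Z (reconciler: no traction for 6.6 d (last activity item-evidence-added at 2026-08-17T15:24:01Z); parked, not closed — `ledger route dormant route-Langlands-EvenVoidBelowEight --off` to reactivate) — unstaffed, not closed; items shared with open routes are served there. `ledger route dormant <id> --off` reactivates.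

# Route EvenVoidBelowEight — Calegari's even Fontaine–Mazur theorem below its printed bound p > 7 —
the symmetric-power shadow and the two inadequate 3-adic images

NEAR-MISS HARVEST (lens 3.15; artefact DEFICIT.md in the planner folder). Calegari II
(arXiv:1012.4819, JAMS 25, Thm 1.1) proves that the even, regular-weight, residually-big rank-2
sector of clause (B) over ℚ is VOID for p > 7 (and under a local-shape hypothesis (c) at p): no
continuous even ρ : Γ_ℚ → GL₂(ℚ̄_p), unramified a.e., potentially semistable at p with distinct
Hodge–Tate weights, with ρ̄ absolutely irreducible and non-dihedral. It suffices to show X =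
EvenRegularVoidOdd: the same voidness at EVERY ODD p and without (c) — typed over the Statement's
own cone (pinned Fontaine datum; `labelledHodgeTateWeightsAt … .Nodup` = distinct weights; `IsEven`,
`residualRep`, `IsDihedralType`, `projectiveImage`) — as the conjunction of four cruxes cut along
the re-derived deficit: C1 (p = 3, projective residual image of order 12 = A₄ or 360 = A₆: the two
images outside every adequacy theorem), C2 (p = 3, all other images), C3 (p ∈ {5,7}: Sym² shadow
where adequate, Steinberg/Sym⁴ shadow at the Guralnick–Herzig–Tiep exceptional images), C4 (p ≥ 11
with hypothesis (c) removed by Tung 2021). The rest of the summit is the support item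
EvenVoidSectorToLanglands (X → Langlands), not attacked here.
Lean: `∀ (p : ℕ) [Fact p.Prime], p ≠ 2 → ∀ (ρ :
Literature.NumberTheory.GaloisRepresentations.FramedGaloisRep ℚ (PadicAlgCl p) 2), ρ.IsEven → (∀ᶠ v
: IsDedekindDomain.HeightOneSpectrum (NumberField.RingOfIntegers ℚ) in Filter.cofinite,
ρ.IsUnramifiedAt v) → (∀ (v : IsDedekindDomain.HeightOneSpectrum (NumberField.RingOfIntegers ℚ)) (hv
: ((p : ℕ) : NumberField.RingOfIntegers ℚ) ∈ v.asIdeal),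
(Literature.NumberTheory.PAdicHodge.fontainePstAdicCompletion v p hv).IsDeRhamFramed (ρ.toLocal v) ∧
∀ τ : v.adicCompletion ℚ →+* PadicAlgCl p, Continuous τ → (ρ.labelledHodgeTateWeightsAt v
(Literature.NumberTheory.PAdicHodge.fontainePstAdicCompletion v p hv).algebra
(Literature.NumberTheory.PAdicHodge.fontainePstAdicCompletion v p hv).𝔅 τ).Nodup) →
ρ.IsResiduallyAbsIrreducible → ¬ Literature.NumberTheory.GaloisRepresentations.IsDihedralType
ρ.residualRep → False`

## Assembly
Pure logic, certified by the deciding theorem in glue.lean (rc 0 in Sketch.lean / RenderTest.lean):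
`closes : ThreeAdicInadequateImages → ThreeAdicAdequateImages → FiveSevenSteinbergShadow →
LargePrimesNoLocalShape → EvenVoidSectorToLanglands → Langlands` := EvenVoidSectorToLanglands
applied to the target, which is assembled inline from the four cruxes by a case split on p (p = 3; p
∈ {5,7}; else 11 ≤ p by `interval_cases` on an odd prime ∉ {3,5,7}) and, at p = 3, on `Nat.card
(projectiveImage ρ̄) ∈ {12, 360}` (classical `by_cases`).

Rationale: WHY THIS LINE. The printed chain (Calegari II §§3–4: Moret-Bailly/Snowden residual realisation →
Kisin component realisation of ρ|D_p by a Hilbert modular shadow g → ordinary RACSDC lift π of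
Sym²ρ̄ over a CM field (BLGGT Prop 3.3.1) → second shadow h → potential automorphy of the
9-dimensional compatible system Sym²ρ_g ⊗ ρ_π (BLGGT Thm A) → adequate lifting of ϱ = Sym²ρ ⊗
Sym²ρ_h → tr ϱ(c) = +3 against Taylor's sign theorem doi:10.2140/ant.2012.6.405) was re-derived link
by link (DEFICIT.md §1): p > 7 enters ONLY through residual-image technology (`l ≥ 2(d+1)` in BLGGT
3.3.1, d = 3; bigness of SL₂(𝔽_p) ⊂ GL₂ in Prop 3.10, p > 5), and hypothesis (c) ONLY through
Kisin's component realisation. Both inputs MOVED: adequacy for p > d with an explicit exception list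
(arXiv:1311.1786 Thm 1.3; arXiv:1405.0043 Thm 1.7, Cor 9.4–9.5, extended adequacy allowing p ∣ dim),
and "every potentially semistable component of R(ρ̄|G_ℚ_p) is automorphic" for all p > 2 (Tung,
arXiv:1803.07451 = ANT 15 (2021); p = 2: arXiv:1908.06174). Re-running with today's inputs empties p
= 5, 7 provided one changes the functorial shadow — Sym² is forced by SIGN (an even ρ is
symplectically polarised with the wrong parity) but ANY even symmetric power is orthogonal of odd
rank with tr Sym^(2m)ρ(c)·tr Sym^(2m)ρ_h(c) = 2m+1 ≠ ±1, and Sym⁴ (p = 7, Klein images) resp. St₅ =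
Sym⁴ (p = 5, icosahedral-type images) are adequate where Sym² is not — and leaves exactly two 3-adic
images, A₄ (not even weakly adequate: V₄ ◁ A₄ of index 3) and A₆ ≅ PSL₂(𝔽₉) (H¹(G, End V/k) ≠ 0), at
a proved ceiling of the adequate Taylor–Wiles class: crux C1, a new-method crux (ℓ-adic-image
patching à la Newton–Thorne arXiv:1912.11265, or a Khare–Thorne-type functorial detour). Imported
areas: modular representation theory of finite groups of Lie type (adequacy, Ext¹, Steinberg
modules) steering an automorphy-lifting chain; p-adic local Langlands for GL₂(ℚ_p) (Tung) replacing
Kisin. No listed route touches the residually IRREDUCIBLE even regular sector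
(EvenSkinnerWilesMirror, MirrorPairReflection = residually reducible; the eight even-Artin routes =
equal weights); Calegari's ICM survey arXiv:2109.14145 §9.7 prints the deficit ("still fall short …
even for p > 7"), and none of the 94 works citing Calegari I/II lowers it.

RANKED CRUXES. #0 EvenRegularVoidOdd (target) — for every odd prime p there is no ρ : Γ_ℚ →
GL₂(ℚ̄_p), continuous, EVEN, unramified at all but finitely many places, de Rham at the place above
p (pinned Fontaine datum) with multiplicity-free labelled Hodge–Tate weights for every continuous
label, residually absolutely irreducible and not of dihedral type (Calegari II Thm 1.1 with p > 7 ↦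
p odd and hypothesis (c) dropped). (why it might fail: at p = 3 the two inadequate images (C1) may
genuinely carry even regular deformations (Calegari II Thm 1.4 shows residual reps with NO geometric
deformations exist; the converse phenomenon is not excluded by any theorem).) [arXiv:1012.4819,
arXiv:0907.3427, arXiv:2109.14145, FontaineMazurGeometric1995]
#2 ThreeAdicInadequateImages (crux) — the target at p = 3 for ρ̄ with projective image of order 12
(A₄ ≅ PSL₂(𝔽₃)) or 360 (A₆ ≅ PSL₂(𝔽₉)) — the two residual images for which EVERY functorial shadow
usable in Calegari's chain is a catalogued adequacy exception (GHT-II Thm 1.7 (ii),(iii)); the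
binding input of the near-miss, typed with its numbers (3, 12, 360). [difficulty: open-problem] (why
it might fail: A₄ on Sym² is not even weakly adequate (semisimple span 3/9, computed) and (A₆,
L(2)/𝔽₉) has H¹(G,End V/k) ≠ 0: no Taylor–Wiles lifting theorem applies, Sym^k (k ≥ 3) is reducible
for SL₂(𝔽₃) and tensor shadows have d = 4 > p; a genuinely new lifting engine is needed.)
[arXiv:1405.0043, arXiv:1311.1786, arXiv:1012.4819, arXiv:1912.11265, arXiv:1107.5993]
#3 ThreeAdicAdequateImages (crux) — the target at p = 3 for all other residual images (S₄, A₅,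
PGL₂(𝔽₉), PSL₂/PGL₂(𝔽_(3^a)) with a ≥ 3): re-run Calegari's chain in degree d = p = 3 with Thorne's
extended adequacy (3 ∣ dim Sym²; GHT-II Thm 1.7, Cor 9.4, Cor 9.5, Prop 6.6) and Tung's component
realisation at p = 3. [difficulty: XL] (why it might fail: at p = 3 every image has Sym² of
dimension p, the 9-dimensional product ϱ̄ (dim p², outside all classification theorems) must be
shown extended-adequate by hand, Geraghty/BLGGT ordinary inputs are printed for l > 2 only but
ζ₃-fields and 3 ∣ 9 stress every 'l ∤ n' clause.) [arXiv:1405.0043, arXiv:1803.07451,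
arXiv:1012.4819, arXiv:1010.2561]
#4 FiveSevenSteinbergShadow (crux) — the target at p = 5 and p = 7, all residual images: Sym² shadow
where adequate (GHT Thm 1.3, GHT-II Cor 9.5), and at the exceptional images — PSL₂(𝔽₇) (order 168)
at p = 7; A₅ (60) and S₅ with sign field ℚ(√5) at p = 5 — the Sym⁴ shadow (L(4), d = 5 < 7,
adequate; resp. St₅ = L(4), d = 5 = p, projective, extended-adequate by GHT-II Cor 9.4), with tr
ϱ(c) = +5 against Taylor's sign theorem. [difficulty: L] (why it might fail: the Sym⁴ chain needs
ordinary automorphic lifts of Sym⁴ρ̄ on U(5) with Hodge type Sym⁴w, Geraghty connectivity on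
GL₅/GL₂₅ and very-smooth Sym⁴-tensor points — each printed only with l ≥ 2(d+1) (d = 5 ⇒ l ≥ 12) —
and extended adequacy (5 ∣ dim St₅) inside every lifting theorem used.) [arXiv:1012.4819,
arXiv:1311.1786, arXiv:1405.0043, arXiv:1010.2561, doi:10.2140/ant.2012.6.405]
#5 LargePrimesNoLocalShape (crux) — the target for p ≥ 11 WITHOUT Calegari's hypothesis (c) (ρ̄|D_p
may be a twist of (ε̄ * ; 0 1)): Calegari II verbatim, with Kisin's component realisation (Prop 3.7,
Remark 3.8) replaced by Tung 2021 'every irreducible component of the potentially semistable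
deformation ring of ρ̄|G_ℚ_p is automorphic' (p > 2). [difficulty: M] (why it might fail: Tung's
components live on the CEGGPS definite-unitary patched module; Prop 3.7 needs them realised by a
Hilbert modular form over F₂⁺ (p split completely) with prescribed big residual image — a CEG-type
transfer between global settings (arXiv:1807.03529, printed with p > 2(n+1)).) [arXiv:1803.07451,
arXiv:1012.4819, arXiv:1807.03529, arXiv:1908.06174]
#9 EvenVoidSectorToLanglands (support) — the honest rest of the summit along this line — Langlands
given the voidness of the even regular residually-big rank-2 sector over ℚ (clause (A) entirely,
clause (B) for odd ρ, other fields, n ≠ 2, equal weights, residually reducible/dihedral even ρ); NOT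
attacked by this route, shared in kind with every sector route of the summit. [difficulty:
open-problem] [BuzzardGeeLMS2014, FontaineMazurGeometric1995]

TWO-LAYER PLAN. Foreseen glued splits (k ≤ 3, depth 1), filed only when a crux closes or stalls: C1
⇐ (order 12, tetrahedral) → (order 360, A₆) → C1 (= the BC3 birth skeleton
bc/ThreeAdicInadequateImages_birth.lean); C2 ⇐ (orders 24, 60: prime-to-9 images) → (Lie-type
images) → C2; C3 ⇐ (p = 5) → (p = 7) → C3; C4 ⇐ (hypothesis (c) holds: Calegari verbatim) → ((ε̄ *;0
1)-shape: Tung) → C4 — all four typed and kernel-checked in bc/*_birth.lean.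

KILL CRITERIA. (K1) An even ρ of regular weight with big residual image at ANY odd p refutes the
target and clause (B) of the summit at once (Fontaine–Mazur fails): close
`refuted:EvenRegularVoidOdd` and file ¬Langlands evidence. (K2) A refuter's GAP/MeatAxe audit of
DEFICIT §2 finding (A₅, St₅) or (PSL₂(7), L(4)) inadequate moves that cell from C3 to the ceiling:
restate C1/C3 by image (refuted-misstated ranks, not the line). (K3) A printed small-prime sequel of
Calegari II makes C3/C4 `known`: superseded for staffing, the route still decides its sector. (K4)
If C1 is shown to require the automorphy of even icosahedral ARTIN representations (the residual
field of an A₅-type ρ̄ at p = 5 is an even icosahedral Artin field — NOT the case for C1's A₄/A₆ at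
p = 3, but the analogous reduction would be), C1 is summit-corner-hard: demote the route to dormant
with the census.

NOT DECOMPOSED YET. p = 2 (central-character parity makes every GL₂ Hecke module of the needed type
zero, so the Sym² detour is still required, with Thorne's 2-adic unitary lifting + Tung 2020 — a
later crux); the residually dihedral even case (Sym² reducible, no shadow); residually reducible
even ρ (routes EvenSkinnerWilesMirror / MirrorPairReflection); the transfer of Tung's component
statement to Kisin's Hilbert setting (inside C4); the hand computation of extended adequacy for the
9- and 25-dimensional product images (inside C2/C3); any use of Pan's locally analytic method as a
second engine for the shadow step.

CHEAPEST FALSIFIER. The adequacy bookkeeping of DEFICIT.md §2, a one-afternoon GAP/MeatAxe job: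
Ext¹_G(V,V), H¹(G,(V*⊗V)/k) and the span of semisimple elements for (A₅, L(4))/𝔽₅, (PSL₂(7),
L(4))/𝔽₇, (S₄, L(2)) and (A₄, L(2))/𝔽₃, (A₆, L(2))/𝔽₉. Run here for the two 𝔽₃ cells by exact linear
algebra (2026-08-17): S₄ — 16 semisimple elements span End(V) (9/9, both 3-dim modules); A₄ — span
3/9 (fails), confirming C1's placement. Literature kill already run: lit citing on both Calegari
DOIs (94 works), zbMATH/crossref 'even Galois representations Fontaine–Mazur' — no small-prime
sequel.

NUMBERS. Printed: p > 7 (Calegari II Thm 1.1/1.2; Prop 3.9 uses p ≥ 2(3+1), Prop 3.10 'p > 5');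
Calegari I Thm 1.2: p > 7, ordinary, SL₂(𝔽_p) ⊂ im ρ̄, [E(ζ_p)⁺:E] > 2. BLGGT: l ≥ 2(d+1) (Prop
3.3.1, Thm 4.2.1, 4.3.1, 4.5.1), l > 2(n+1) (Thm 4.4.1). GHTT: adequate if d ≤ (p−3)/2; GHT 2015: p
> d minus exceptions (H = PSL₂(p), d = (p±1)/2; SL₂(p)×SL₂(p^a), d = p−1; p = (q+1)/2; Fermat p, d =
p−2; (3A₆,5,3), (2A₇,7,4); (SL₂(3^a),3,2)); GHT-II 2017: d = p adequate unless normal abelian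
subgroup of index p or (3, PSL₂(9)). Tung 2021: p > 2, all pst components; CEG: p > 2(n+1). This
route: v₀ = 8 → v* = 5 inside the class (C3, C4) → v₁ = 3 with two ceiling images (C1). Items at
open: 7 (target, 4 cruxes, support, assembly).

DEFINITION REQUESTS. None: FramedGaloisRep.IsEven, IsUnramifiedAt, toLocal,
labelledHodgeTateWeightsAt, IsResiduallyAbsIrreducible, residualRep, IsDihedralType,
projectiveImage, PstWeilDeligneData.IsDeRhamFramed, fontainePstAdicCompletion all exist (lean search
--decl; Sketch.lean rc 0). Cite facts a prover will want as named Literature facts (not filed now,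
D-0027 §3.3 first-prover duty): Calegari II Thm 1.2 (arXiv:1012.4819), Tung 2021 Thm 1/§4
(arXiv:1803.07451), GHT Thm 1.3 (arXiv:1311.1786), GHT-II Thm 1.7 / Cor 9.4 / Cor 9.5
(arXiv:1405.0043), Taylor 2012 Prop A (doi:10.2140/ant.2012.6.405), BLGGT Thm 4.2.1/4.5.1
(arXiv:1010.2561).

Novelty: Searches (2026-08-17): lit citing doi:10.1007/s00222-010-0297-0 (60 works) and
doi:10.1090/s0894-0347-2011-00721-2 (34 works) — no sequel lowering p > 7 or the image hypotheses;
lit search --source zbmath 'even Galois representations Fontaine-Mazur' (3: Calegari I,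
Skinner–Wiles, Hajir–Maire) and --source crossref 'even Galois representations distinct Hodge-Tate
weights' (15, none relevant); lit search --source zbmath/crossref for GHT adequacy (2) and Tung (5);
lit galaxy search 'Even Galois representations and the Fontaine-Mazur conjecture' --star all (1
book-list hit); ledger negatives --problem Langlands (3, unrelated); grep of the 78 Theses and 131
idea cards for Calegari2011/1012.4819/adequa (EvenSkinnerWilesMirror, MirrorPairReflection,
NonParallelVoid, SelfDefeatingInduction, thickened-residual-patching read); local searchd/OpenAlex
unavailable this session (rc reset / 429). Reads: arXiv:1012.4819 pp. 1–13, 15; arXiv:0907.3427 pp.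
1–3; arXiv:1311.1786 pp. 1–3; arXiv:1405.0043 pp. 2–5, 19–20, 24–25, 33–34; arXiv:1010.2561 Prop
3.3.1, Thm 4.2.1/4.3.1/4.4.1/4.5.1; arXiv:1803.07451 pp. 1–3; arXiv:1908.06174 pp. 1–3;
arXiv:1807.03529 pp. 1–3; arXiv:2607.11763 pp. 1–7; arXiv:2109.14145 §9.7, §12.
Nearest prior art found: Calegari II arXiv:1012.4819 §6 (names the deficit and the expected p = 7,
5, 3 image conditions for the Sym² shadow, does not re-run) and Calegari arXiv:2109.14145 §9.7;
routes EvenSkinnerWilesMirror / MirrorPairReflection (the residually REDUCIBLE even regu  [refs: 10.1007/s00222-010-0297-0, 10.1090/s0894-0347-2011-00721-2, 1012.4819, 0907.3427, 1311.1786, 1405.0043, 1010.2561, 1803.07451, 1908.06174, 1807.03529, 2607.11763, 2109.14145, doi:10.1007/s00222-010-0297-0, doi:10.1090/s0894-0347-2011-00721-2, book-list, Calegari2011]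

Barriers (technique_class: automorphy-lifting, symmetric-power-shadow, adequacy): - technique_class: automorphy-lifting, symmetric-power-shadow, adequacy
- Literature.Barriers.Langlands.TaylorWilesNumericalCoincidence: evaded exactly as in Calegari II —
the even rank-2 ρ (defect ℓ₀ = 1 over ℚ) is never patched; only odd-rank orthogonal Sym^(2m)-shadows
over CM fields on definite unitary groups (ℓ₀ = 0) are, where the coincidence holds.
- Literature.Barriers.Langlands.TaylorWilesNumericalCoincidenceNarrow: same escaping hypothesis —
every patched object is conjugate self-dual of odd rank over a CM field (defect zero); the even ρ
itself is only contradicted, never lifted.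
- Literature.Barriers.Langlands.ResiduallyReducibleBarrier: out of sector by hypothesis (ρ̄
absolutely irreducible, non-dihedral; the shadows ρ̄_g, ρ̄_h are CHOSEN with image SL₂(𝔽_(p^a)), a ≥
2); residual reducibility is the business of EvenSkinnerWilesMirror / MirrorPairReflection.
- Literature.Barriers.Langlands.ResiduallyReducibleBarrierNarrow: its adequate-image clause is NOT
evaded at (3, A₄), (3, A₆) — it IS crux C1, stated as the ceiling (GHT-II Thm 1.7); it is evaded at
(5, A₅/S₅) and (7, PSL₂(7)) by changing the functorial shadow to St₅ / Sym⁴ (GHT-II Cor 9.4/9.5),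
and met by GHT Thm 1.3 everywhere else.
- Literature.Barriers.Langlands.PatchingLocalComponentBarrier: met head-on by the imported theorem
of Tung 2021 (every potentially semistable component of R(ρ̄|G_ℚ_p) carries automorphic points, p >
2) — the escaping hypothesis is K = ℚ_p, n = 2, where p-adic local Langlands exist

History (route lifecycle, newest last):
- 2026-08-24T05:41:55Z · DORMANT — reconciler: no traction for 6.6 d (last activity item-evidence-added at 2026-08-17T15:24:01Z); parked, not closed — `ledger route dormant route-Langlands-EvenVo (operator:999:3421069)

sub-problem: Langlands · status: dormant · opened planner-plan-lens3-Langlands-nearmiss-0 2026-08-17T02:05:11Z · rev 1 · ledger route-Langlands-EvenVoidBelowEight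
GENERATED by the gate from the ledger (D-0016/17). Provers cite these decls: `theorem foo : Summit.Langlands.Langlands.Theses.EvenVoidBelowEight.<Decl> := …` in Summits/Langlands/Langlands/Theorems/<Name>.lean.
-/

namespace Summit.Langlands.Langlands.Theses.EvenVoidBelowEight

open scoped BigOperators Topology Manifold Classical MeasureTheory ProbabilityTheory Matrix InnerProductSpace ComplexConjugate ContinuousMap
open Filter Set Function TopologicalSpace MeasureTheory

attribute [summit_statement] _root_.Langlands

/-- item stmt-Langlands-17640 · target · rank 0 · open · by planner
why it might fail: at p = 3 the two inadequate images (C1) may genuinely carry even regular deformations (Calegari II Thm 1.4 shows residual reps with NO geometric deformations exist; the converse phenomenon is not excluded by any theorem).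
sources: arXiv:1012.4819, arXiv:0907.3427, arXiv:2109.14145, FontaineMazurGeometric1995
[target] for every odd prime p there is no ρ : Γ_ℚ → GL₂(ℚ̄_p), continuous, EVEN, unramified at all
but finitely many places, de Rham at the place above p (pinned Fontaine datum) with
multiplicity-free labelled Hodge–Tate weights for every continuous label, residually absolutely
irreducible and not of dihedral type (Calegari II Thm 1.1 with p > 7 ↦ p odd and hypothesis (c)
dropped). -/
@[route_item "route-Langlands-EvenVoidBelowEight"]
def EvenRegularVoidOdd : Prop :=
  ∀ (p : ℕ) [Fact p.Prime], p ≠ 2 → ∀ (ρ : Literature.NumberTheory.GaloisRepresentations.FramedGaloisRep ℚ (PadicAlgCl p) 2), ρ.IsEven → (∀ᶠ v : IsDedekindDomain.HeightOneSpectrum (NumberField.RingOfIntegers ℚ) in Filter.cofinite, ρ.IsUnramifiedAt v) → (∀ (v : IsDedekindDomain.HeightOneSpectrum (NumberField.RingOfIntegers ℚ)) (hv : ((p : ℕ) : NumberField.RingOfIntegers ℚ) ∈ v.asIdeal), (Literature.NumberTheory.PAdicHodge.fontainePstAdicCompletion v p hv).IsDeRhamFramed (ρ.toLocal v) ∧ ∀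 τ : v.adicCompletion ℚ →+* PadicAlgCl p, Continuous τ → (ρ.labelledHodgeTateWeightsAt v (Literature.NumberTheory.PAdicHodge.fontainePstAdicCompletion v p hv).algebra (Literature.NumberTheory.PAdicHodge.fontainePstAdicCompletion v p hv).𝔅 τ).Nodup) → ρ.IsResiduallyAbsIrreducible → ¬ Literature.NumberTheory.GaloisRepresentations.IsDihedralType ρ.residualRep → False

/-- item stmt-Langlands-17642 · crux · rank 2 · open · by planner
why it might fail: A₄ on Sym² is not even weakly adequate (semisimple span 3/9, computed) and (A₆, L(2)/𝔽₉) has H¹(G,End V/k) ≠ 0: no Taylor–Wiles lifting theorem applies, Sym^k (k ≥ 3) is reducible for SL₂(𝔽₃) and tensor shadows have d = 4 > p; a genuinely new lifting engine is needed.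
sources: arXiv:1405.0043, arXiv:1311.1786, arXiv:1012.4819, arXiv:1912.11265, arXiv:1107.5993
[crux] the target at p = 3 for ρ̄ with projective image of order 12 (A₄ ≅ PSL₂(𝔽₃)) or 360 (A₆ ≅
PSL₂(𝔽₉)) — the two residual images for which EVERY functorial shadow usable in Calegari's chain is
a catalogued adequacy exception (GHT-II Thm 1.7 (ii),(iii)); the binding input of the near-miss,
typed with its numbers (3, 12, 360). [difficulty: open-problem] -/
@[route_item "route-Langlands-EvenVoidBelowEight", crux]
def ThreeAdicInadequateImages : Prop :=
  ∀ (ρ : Literature.NumberTheory.GaloisRepresentations.FramedGaloisRep ℚ (PadicAlgCl 3) 2), ρ.IsEven → (∀ᶠ v : IsDedekindDomain.HeightOneSpectrum (NumberField.RingOfIntegers ℚ) in Filter.cofinite, ρ.IsUnramifiedAt v) → (∀ (v : IsDedekindDomain.HeightOneSpectrum (NumberField.RingOfIntegers ℚ)) (hv : ((3 : ℕ) : NumberField.RingOfIntegers ℚ) ∈ v.asIdeal), (Literature.NumberTheory.PAdicHodge.fontainePstAdicCompletion v 3 hv).IsDeRhamFramed (ρ.toLocal v) ∧ ∀ τ :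 v.adicCompletion ℚ →+* PadicAlgCl 3, Continuous τ → (ρ.labelledHodgeTateWeightsAt v (Literature.NumberTheory.PAdicHodge.fontainePstAdicCompletion v 3 hv).algebra (Literature.NumberTheory.PAdicHodge.fontainePstAdicCompletion v 3 hv).𝔅 τ).Nodup) → ρ.IsResiduallyAbsIrreducible → ¬ Literature.NumberTheory.GaloisRepresentations.IsDihedralType ρ.residualRep → (Nat.card (Literature.NumberTheory.GaloisRepresentations.projectiveImage ρ.residualRep) = 12 ∨ Nat.card (Literature.NumberTheory.GaloisRepresentations.projectiveImage ρ.residualRep) = 360) → False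

/-- item stmt-Langlands-17643 · crux · rank 3 · open · by planner
why it might fail: at p = 3 every image has Sym² of dimension p, the 9-dimensional product ϱ̄ (dim p², outside all classification theorems) must be shown extended-adequate by hand, Geraghty/BLGGT ordinary inputs are printed for l > 2 only but ζ₃-fields and 3 ∣ 9 stress every 'l ∤ n' clause.
sources: arXiv:1405.0043, arXiv:1803.07451, arXiv:1012.4819, arXiv:1010.2561
[crux] the target at p = 3 for all other residual images (S₄, A₅, PGL₂(𝔽₉), PSL₂/PGL₂(𝔽_(3^a)) with
a ≥ 3): re-run Calegari's chain in degree d = p = 3 with Thorne's extended adequacy (3 ∣ dim Sym²;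
GHT-II Thm 1.7, Cor 9.4, Cor 9.5, Prop 6.6) and Tung's component realisation at p = 3. [difficulty:
XL] -/
@[route_item "route-Langlands-EvenVoidBelowEight", crux]
def ThreeAdicAdequateImages : Prop :=
  ∀ (ρ : Literature.NumberTheory.GaloisRepresentations.FramedGaloisRep ℚ (PadicAlgCl 3) 2), ρ.IsEven → (∀ᶠ v : IsDedekindDomain.HeightOneSpectrum (NumberField.RingOfIntegers ℚ) in Filter.cofinite, ρ.IsUnramifiedAt v) → (∀ (v : IsDedekindDomain.HeightOneSpectrum (NumberField.RingOfIntegers ℚ)) (hv : ((3 : ℕ) : NumberField.RingOfIntegers ℚ) ∈ v.asIdeal), (Literature.NumberTheory.PAdicHodge.fontainePstAdicCompletion v 3 hv).IsDeRhamFramed (ρ.toLocal v) ∧ ∀ τ : v.adicCompletion ℚ →+* PadicAlgCl 3, Continuous τ → (ρ.labelledHodgeTateWeightsAt v (Literature.NumberTheory.PAdicHodge.fontainePstAdicCompletion v 3 hv).algebra (Literature.NumberTheory.PAdicHodge.fontainePstAdicCompletion v 3 hv).𝔅 τ).Nodup) → ρ.IsResiduallyAbsIrreducible → ¬ Literature.NumberTheory.GaloisRepresentations.IsDihedralType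 ρ.residualRep → ¬ (Nat.card (Literature.NumberTheory.GaloisRepresentations.projectiveImage ρ.residualRep) = 12 ∨ Nat.card (Literature.NumberTheory.GaloisRepresentations.projectiveImage ρ.residualRep) = 360) → False

/-- item stmt-Langlands-17644 · crux · rank 4 · open · by planner
why it might fail: the Sym⁴ chain needs ordinary automorphic lifts of Sym⁴ρ̄ on U(5) with Hodge type Sym⁴w, Geraghty connectivity on GL₅/GL₂₅ and very-smooth Sym⁴-tensor points — each printed only with l ≥ 2(d+1) (d = 5 ⇒ l ≥ 12) — and extended adequacy (5 ∣ dim St₅) inside every lifting theorem used.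
sources: arXiv:1012.4819, arXiv:1311.1786, arXiv:1405.0043, arXiv:1010.2561, doi:10.2140/ant.2012.6.405
[crux] the target at p = 5 and p = 7, all residual images: Sym² shadow where adequate (GHT Thm 1.3,
GHT-II Cor 9.5), and at the exceptional images — PSL₂(𝔽₇) (order 168) at p = 7; A₅ (60) and S₅ with
sign field ℚ(√5) at p = 5 — the Sym⁴ shadow (L(4), d = 5 < 7, adequate; resp. St₅ = L(4), d = 5 = p,
projective, extended-adequate by GHT-II Cor 9.4), with tr ϱ(c) = +5 against Taylor's sign theorem.
[difficulty: L] -/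
@[route_item "route-Langlands-EvenVoidBelowEight", crux]
def FiveSevenSteinbergShadow : Prop :=
  ∀ (p : ℕ) [Fact p.Prime], (p = 5 ∨ p = 7) → ∀ (ρ : Literature.NumberTheory.GaloisRepresentations.FramedGaloisRep ℚ (PadicAlgCl p) 2), ρ.IsEven → (∀ᶠ v : IsDedekindDomain.HeightOneSpectrum (NumberField.RingOfIntegers ℚ) in Filter.cofinite, ρ.IsUnramifiedAt v) → (∀ (v : IsDedekindDomain.HeightOneSpectrum (NumberField.RingOfIntegers ℚ)) (hv : ((p : ℕ) : NumberField.RingOfIntegers ℚ) ∈ v.asIdeal), (Literature.NumberTheory.PAdicHodge.fontainePstAdicCompletion v p hv).IsDeRhamFramed (ρ.toLocal v) ∧ ∀ τ : v.adicCompletion ℚ →+* PadicAlgCl p, Continuous τ → (ρ.labelledHodgeTateWeightsAt v (Literature.NumberTheory.PAdicHodge.fontainePstAdicCompletion v p hv).algebra (Literature.NumberTheory.PAdicHodge.fontainePstAdicCompletion v p hv).𝔅 τ).Nodup) → ρ.IsResiduallyAbsIrreducible → ¬ Literature.NumberTheory.GaloisRepresentations.IsDihedralType ρ.residualRep → False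

/-- item stmt-Langlands-17645 · crux · rank 5 · open · by planner
why it might fail: Tung's components live on the CEGGPS definite-unitary patched module; Prop 3.7 needs them realised by a Hilbert modular form over F₂⁺ (p split completely) with prescribed big residual image — a CEG-type transfer between global settings (arXiv:1807.03529, printed with p > 2(n+1)).
sources: arXiv:1803.07451, arXiv:1012.4819, arXiv:1807.03529, arXiv:1908.06174
[crux] the target for p ≥ 11 WITHOUT Calegari's hypothesis (c) (ρ̄|D_p may be a twist of (ε̄ * ; 0
1)): Calegari II verbatim, with Kisin's component realisation (Prop 3.7, Remark 3.8) replaced by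
Tung 2021 'every irreducible component of the potentially semistable deformation ring of ρ̄|G_ℚ_p is
automorphic' (p > 2). [difficulty: M] -/
@[route_item "route-Langlands-EvenVoidBelowEight", crux]
def LargePrimesNoLocalShape : Prop :=
  ∀ (p : ℕ) [Fact p.Prime], 11 ≤ p → ∀ (ρ : Literature.NumberTheory.GaloisRepresentations.FramedGaloisRep ℚ (PadicAlgCl p) 2), ρ.IsEven → (∀ᶠ v : IsDedekindDomain.HeightOneSpectrum (NumberField.RingOfIntegers ℚ) in Filter.cofinite, ρ.IsUnramifiedAt v) → (∀ (v : IsDedekindDomain.HeightOneSpectrum (NumberField.RingOfIntegers ℚ)) (hv : ((p : ℕ) : NumberField.RingOfIntegers ℚ) ∈ v.asIdeal), (Literature.NumberTheory.PAdicHodge.fontainePstAdicCompletion v p hv).IsDeRhamFramed (ρ.toLocal v) ∧ ∀ τ : v.adicCompletion ℚ →+* PadicAlgCl p, Continuous τ → (ρ.labelledHodgeTateWeightsAt v (Literature.NumberTheory.PAdicHodge.fontainePstAdicCompletion v p hv).algebra (Literature.NumberTheory.PAdicHodge.fontainePstAdicCompletion v p hv).𝔅 τ).Nodup) → ρ.IsResiduallyAbsIrreducible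 → ¬ Literature.NumberTheory.GaloisRepresentations.IsDihedralType ρ.residualRep → False

/-- item stmt-Langlands-17646 · support · rank 9 · open · by planner
sources: BuzzardGeeLMS2014, FontaineMazurGeometric1995
[support] the honest rest of the summit along this line — Langlands given the voidness of the even
regular residually-big rank-2 sector over ℚ (clause (A) entirely, clause (B) for odd ρ, other
fields, n ≠ 2, equal weights, residually reducible/dihedral even ρ); NOT attacked by this route,
shared in kind with every sector route of the summit. [difficulty: open-problem] -/
@[route_item "route-Langlands-EvenVoidBelowEight", crux]
def EvenVoidSectorToLanglands : Prop :=
  EvenRegularVoidOdd → Langlands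

/-- item stmt-Langlands-17647 · assembly · rank 1 · open · by planner
sources: arXiv:1012.4819, BuzzardGeeLMS2014
[assembly] ThreeAdicInadequateImages → ThreeAdicAdequateImages → FiveSevenSteinbergShadow →
LargePrimesNoLocalShape → EvenVoidSectorToLanglands → Langlands. -/
@[route_item "route-Langlands-EvenVoidBelowEight"]
def Assembly : Prop :=
  ThreeAdicInadequateImages → ThreeAdicAdequateImages → FiveSevenSteinbergShadow → LargePrimesNoLocalShape → EvenVoidSectorToLanglands → Langlands

/-! D-0027 §2.1 — DECIDING THEOREM (planner-authored via `route open/edit --closes-file`; by planner-plan-lens3-Langlands-nearmiss-0 2026-08-17T02:05:11Z):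
its hypotheses are this route's items and its conclusion the sub-problem Statement (glue_lint), and it elaborates with this file. -/

@[closes "route-Langlands-EvenVoidBelowEight"] theorem closes (h1 : ThreeAdicInadequateImages) (h2 : ThreeAdicAdequateImages)
    (h3 : FiveSevenSteinbergShadow) (h4 : LargePrimesNoLocalShape)
    (hJ : EvenVoidSectorToLanglands) : Langlands := by
  refine hJ ?_
  intro p _ hp2 ρ hev hur hdR hirr hdih
  by_cases h3p : p = 3
  · subst h3p
    by_cases himg : Nat.card (Literature.NumberTheory.GaloisRepresentations.projectiveImage ρ.residualRep) = 12 ∨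
        Nat.card (Literature.NumberTheory.GaloisRepresentations.projectiveImage ρ.residualRep) = 360
    · exact h1 ρ hev hur hdR hirr hdih himg
    · exact h2 ρ hev hur hdR hirr hdih himg
  by_cases h57 : p = 5 ∨ p = 7
  · exact h3 p h57 ρ hev hur hdR hirr hdih
  have hp : p.Prime := Fact.out
  have h11 : 11 ≤ p := by
    by_contra hlt
    push_neg at hlt h57
    interval_cases p <;> first | omega | exact absurd hp (by decide)
  exact h4 p h11 ρ hev hur hdR hirr hdih

end Summit.Langlands.Langlands.Theses.EvenVoidBelowEight
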